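import Summits.Parity.BatemanHorn.Theorems.NormalFamilyBound.Negative.RealAxis

/-!
# Sketch — crux idea `poisson-extraction-positivity` (crux stmt-Parity-9769 `NormalFamilyBound`, round 2, ideator 4)

Objects and first statements of the line (defs only, no sorry):
* `almostPrimeCount f x j = π_j(x) = #{n ≤ x : Ω_f(n) = j}`;
* `poissonDefect f x lam m = Δ_m(x; lam) = Σ_{i ≤ m} π_{k+i}(x) · (−lam)^{m−i} / (m−i)!`
  — the Taylor coefficients at 0 of `N_x(z) := e^{−lam·z} · Σ_m π_{k+m}(x) z^m`;
* `PoissonExtractionPositivity` (PM): with `lam = k·log log x − C` all `Δ_m(x; lam) ≥ 0` for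
  `m ≤ c·log x − K·log log x` (C, K, c > 0, x₀ depending on f; in the model c = 1/log R_f, R_f the least prime
  with roots of unbounded multiplicity: log₂ x for (X), (X, X+2); log₅ x for X²+1);
* `extractableParameter` λ*_J(x): the largest lam for which `Δ_m(x; lam) ≥ 0` for all `m ≤ J` (the card's invariant);
* `RealAxisUpperOrder` (Nair–Tenenbaum order of magnitude, y < 2 — in print, unproved in the tree);
* `DiscBound` (uniform bound on the closed disc `|z| ≤ 9/5 ⊃ V_{1/4}`), `PringsheimTransfer`, `Transfer`.
-/

namespace Summit.Parity.BatemanHorn.Cruxes.NormalFamilyBound.PoissonExtraction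

open Finset Summit.Parity.BatemanHorn.Theorems.NormalFamilyBound.Negative
open Literature.NumberTheory.Sieve Polynomial

noncomputable section

/-- `π_j(x) = #{0 ≤ n ≤ x : Ω_f(n) = j}` with the crux's junk conventions (`Ωf`). -/
def almostPrimeCount {k : ℕ} (f : Fin k → ℤ[X]) (x j : ℕ) : ℕ :=
  ((range (x + 1)).filter (fun n => Ωf f n = j)).card

/-- `Δ_m(x; lam) = Σ_{i ≤ m} π_{k+i}(x) (−lam)^{m−i}/(m−i)!` — the `m`-th Taylor coefficient at `0` of
`e^{−lam z} Σ_m π_{k+m}(x) z^m`. -/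
def poissonDefect {k : ℕ} (f : Fin k → ℤ[X]) (x : ℕ) (lam : ℝ) (m : ℕ) : ℝ :=
  ∑ i ∈ range (m + 1), (almostPrimeCount f x (k + i) : ℝ) * (-lam) ^ (m - i) / ((m - i).factorial : ℝ)

/-- The card's invariant, truncated at `J`: the Poisson-extractable parameter
`λ*_J(x) = sup {lam ≥ 0 : Δ_m(x; lam) ≥ 0 for all m ≤ J}` (a real number in `[0, ∞]`, here as an `sSup`). -/
def extractableParameter {k : ℕ} (f : Fin k → ℤ[X]) (x J : ℕ) : ℝ :=
  sSup {lam : ℝ | 0 ≤ lam ∧ ∀ m ≤ J, 0 ≤ poissonDefect f x lam m}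

/-- (PM) POISSON-EXTRACTION POSITIVITY (the transfer target `C⁺`, first conjunct): for every
Bateman–Horn system there are `C, K`, `c > 0` and `x₀` with `Δ_m(x; k·log log x − C) ≥ 0` for all `x ≥ x₀`
and all `m ≤ c·log x − K·log log x`. Equivalently `λ*_J(x) ≥ k log log x − C` with
`J = ⌊c log x − K log log x⌋`. (Any `c > 0` suffices for `Transfer`; the cutoff is essential: beyond the
live range of `π_j` the coefficients of `e^{−λ z}·(polynomial)` alternate.) -/
def PoissonExtractionPositivity : Prop :=
  ∀ (k : ℕ) (f : Fin k → ℤ[X]), IsBatemanHornSystem f →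
    ∃ C K c : ℝ, 0 < c ∧ ∃ x₀ : ℕ, ∀ x : ℕ, x₀ ≤ x → ∀ m : ℕ,
      (m : ℝ) ≤ c * Real.log x - K * Real.log (Real.log x) →
        0 ≤ poissonDefect f x (k * Real.log (Real.log x) - C) m

/-- Second conjunct of `C⁺` (in print: Nair–Tenenbaum 1998 Thm 1 / Henriot 2012; `f = (X)`: MV Thm 7.18):
real-axis UPPER order of magnitude, uniformly on `0 ≤ y ≤ y₁` for every `y₁ < 2` (needed with `y₁ = 199/100`;
near `y = 0` it is trivial since `π_j(x) = O(1)` for `j < k`). -/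
def RealAxisUpperOrder : Prop :=
  ∀ (k : ℕ) (f : Fin k → ℤ[X]), IsBatemanHornSystem f →
    ∀ y₁ : ℝ, y₁ < 2 → ∃ M : ℝ, ∀ x : ℕ, ∀ y : ℝ, 0 ≤ y → y ≤ y₁ → ‖H k f x y‖ ≤ M

/-- Uniform boundedness of the family on the closed disc `|z| ≤ 9/5` (which contains `V_{1/4}`):
the conclusion the transfer actually yields — strictly more than the crux. -/
def DiscBound : Prop :=
  ∀ (k : ℕ) (f : Fin k → ℤ[X]), IsBatemanHornSystem f →
    ∃ M : ℝ, ∀ x : ℕ, ∀ z : ℂ, ‖z‖ ≤ 9 / 5 → ‖H k f x z‖ ≤ M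

/-- PRINGSHEIM STEP (provable now, pure algebra/analysis): if the first `J+1` Taylor coefficients of
`e^{−lam z} P(z)` are nonnegative, where `P(z) = Σ_{m ≤ J} a_m z^m` has `a_m ≥ 0`, then for every `z`
`‖P(z)‖ ≤ e^{−lam (‖z‖ − Re z)} P(‖z‖) + 2 e^{lam ‖z‖} Σ_{m ≤ J} a_m ‖z‖^m · T_{J−m}(lam ‖z‖)`,
`T_s(u) = Σ_{t > s} u^t/t!` (the Poisson tail that the degree cutoff leaves). Stated for real
coefficient lists. -/
def PringsheimTransfer : Prop :=
  ∀ (J : ℕ) (a : ℕ → ℝ) (lam : ℝ), 0 ≤ lam → (∀ m, 0 ≤ a m) →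
    (∀ m ≤ J, 0 ≤ ∑ i ∈ range (m + 1), a i * (-lam) ^ (m - i) / ((m - i).factorial : ℝ)) →
      ∀ z : ℂ, ‖∑ m ∈ range (J + 1), (a m : ℂ) * z ^ m‖ ≤
        Real.exp (-lam * (‖z‖ - z.re)) * (∑ m ∈ range (J + 1), a m * ‖z‖ ^ m) +
          2 * Real.exp (lam * ‖z‖) * ∑ m ∈ range (J + 1), a m * ‖z‖ ^ m *
            (Real.exp (lam * ‖z‖) - ∑ t ∈ range (J - m + 1), (lam * ‖z‖) ^ t / (t.factorial : ℝ))

/-- THE TRANSFER: `C⁺ := PoissonExtractionPositivity ∧ RealAxisUpperOrder ⇒ DiscBound ⇒ NormalFamilyBound`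
(second implication with `η = 1/4`, since `V_{1/4} ⊂ {|z| ≤ 9/5}`). -/
def Transfer : Prop :=
  (PoissonExtractionPositivity → RealAxisUpperOrder → DiscBound) ∧
    (DiscBound → Summit.Parity.BatemanHorn.Theses.SelbergDelangeRigidity.NormalFamilyBound)

/-- The geometric inclusion used by the second half of `Transfer` (provable now). -/
theorem V_quarter_subset_closedBall :
    V (7 / 4) (1 / 4) ⊆ Metric.closedBall (0 : ℂ) (9 / 5) := by
  rintro z ⟨h1, h2, h3⟩
  rw [Metric.mem_closedBall, dist_zero_right]
  have him := abs_lt.mp h3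
  have hsq : ‖z‖ ^ 2 ≤ (9 / 5) ^ 2 := by
    rw [Complex.sq_norm, Complex.normSq_apply]
    nlinarith [him.1, him.2]
  exact le_of_pow_le_pow_left₀ (by norm_num) (by norm_num) hsq

/-- Second half of `Transfer` (provable now): a uniform bound on the closed disc gives the crux with `η = 1/4`. -/
theorem normalFamilyBound_of_discBound (h : DiscBound) :
    Summit.Parity.BatemanHorn.Theses.SelbergDelangeRigidity.NormalFamilyBound := by
  rw [normalFamilyBound_iff]
  intro k f hf
  obtain ⟨M, hM⟩ := h k f hf
  refine ⟨1 / 4, by norm_num, le_rfl, fun a ha => ⟨M, 1, one_pos, fun x z hz => ?_⟩⟩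
  exact hM x z (by simpa using V_quarter_subset_closedBall hz.2)

end

end Summit.Parity.BatemanHorn.Cruxes.NormalFamilyBound.PoissonExtraction
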